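import Literature.NumberTheory.EllipticCurves.Sprung2024.ChromaticSmallControlProofs
import Literature.NumberTheory.EllipticCurves.Sprung2012.LocalTowerTraceProofs
import Literature.NumberTheory.EllipticCurves.Kobayashi2003.SignedSelmerRankBoundProofs
import Literature.NumberTheory.EllipticCurves.IwasawaSelmerControlKernelProofs
import HarnessLib

/-!
# Sprung 2024, §5.2 Lemma 5.6 (♯/♭ Small Control), the SURJECTIVITY half in corollary form —
# DISCHARGED: `X^•/TX^•` finite ⟹ `Sel_{p^∞}(E/ℚ)` finite (`lem56[AllN]_sharpFlat_finite_selmer_of_finite_coinvariants_holds`)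

`Proofs` file (theorems only: **no definition, no named fact**; axioms standard; net debt −2),
sequel of `Sprung2024/ChromaticSmallControlProofs.lean`. The statement file
`Sprung2024/ChromaticSmallControl.lean` carries (APPEND p491766, cell `bsd-ssimc` seat `k3-c5` g9) the
two NAMED FACTS `lem56_sharpFlat_finite_selmer_of_finite_coinvariants` / `lem56AllN_…`: F. Sprung,
Adv. Math. **449** (2024) 109741, §5.2 **Lemma 5.6** (p. 41) "The natural morphism
`X⋆/XX⋆ ⟶ X⋆_0/XX⋆_0 = X_0` is surjective and has finite kernel", read as «`X⋆/XX⋆` finite ⟹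
`Sel_{p^∞}(E/ℚ)` finite». THIS FILE PROVES BOTH OUTRIGHT (`…_holds`). The surjectivity of the
natural morphism is Pontryagin dual to the existence of the control map
`s_0 : Sel_{p^∞}(E/ℚ) → Sel⋆(E/ℚ_∞)^Γ` (restriction) with finite kernel, and that needs exactly:

* §1 (**`Ker Col⋆` kills the bottom layer**, i.e. `E(ℚ_p) ⊗ ℚ_p/ℤ_p ⊆ E⋆_{0,p}` — the inclusion
  half of "`E♯_{0,p} = E♭_{0,p} = E(ℚ_p) ⊗ ℚ_p/ℤ_p`", [Sprung2024] p. 39, there deduced from "[64,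
  Proposition 5.7] and [64, Definition 7.2 and the preceding discussion] … [65, Proposition 4.7]"):
  PROVED here inside the tree's transcription (`Sprung2012/ColemanMaps.lean`), from the Honda
  relations and the levels `n = 0, 1` of the Coleman characterisation `IsColemanPair` (Def. 7.2:
  "`Col_0 = (−a_p P¹_0 + P⁰_0, −P¹_0)`", "`Col^♭_1 = −P¹_1`"): for `z ∈ Ker Col♭`, `L♭ = 0` and the
  level-`0` congruence `L♭ ≡ −z(c_0) (mod T)` give `z(c_0) = (a_p − 2) z(c_{−1}) = 0`; for
  `z ∈ Ker Col♯`, `L♯ = 0` and the level-`1` congruence `L♯ ≡ −P_{1,c_1}(z) (mod ω_1)` give, at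
  `T = 0`, `z(Tr_{1/0} c_1) = z(a_p c_0 − (p−1) c_{−1}) = (a_p(a_p−2) − (p−1)) z(c_{−1}) = 0`; as
  `p ∣ a_p`, `p ≠ 2`, both integer coefficients are non-zero, so `z(c_{−1}) = 0`, and by the generation
  clause of Thm. 2.2 at level `0` ("`F_ss(𝔪_{−1})` is generated by `c_{−1}`", dual form in
  `IsHondaSystem`) `z` vanishes on `E(ℚ_p)` (`colemanKer_apply_eq_zero_of_mem_localLayerPointsOfEmb_zero`);
* §2 (**`s_0` lands in `Sel⋆(E/K_∞)`**): a classical Selmer class over `K_0 = K` satisfies the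
  `⋆`-condition at `𝔭` after restriction — the classical condition is the Kummer condition cut out by
  `E(K_v)` (tree `Kobayashi2003.localKerOverOfEmb_le_localKummerOverOfEmb_fixedPoints`, the local
  Kummer sequence) and `Ker Col⋆ ⊥ E(K_v)` makes its pairing clause vacuous
  (`layerToInfty_mem_sharpFlatLocalKummerOverOfEmb_of_mem_localKerOver`,
  `layerToInfty_mem_sharpFlatSelmerInfty_of_mem_selmerLayer_zero`);
* §3 (**finite kernel and assembly**): `ker s_0 ⊆ ker h_0` is finite (Greenberg's Lemma 3.1 at
  `n = 0`, tree `Greenberg1999_ker_layerToInfty_bounded_holds` / hypothesis `hker` in the general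
  form), `im s_0 ⊆ Sel⋆(E/K_∞)^γ` (`range_layerToInfty_le_layerInvariants_holds`), which is finite
  iff `X⋆/TX⋆` is (`SharpFlatSelmerDualData.finite_coinvariants_iff`, Pontryagin duality, file
  `ChromaticSmallControlProofs`); hence `Sel_0 ≅ Sel_{p^∞}(E/K)` (`nonempty_selmerLayer_zero_addEquiv`)
  is finite: `finite_selmer_of_finite_sharpFlat_coinvariants_of_colemanKer_apply_eq_zero` (any
  number field / `ℤ_p`-extension / place / data, with §1's conclusion as a hypothesis) and, over `ℚ`
  in the binder shape of the named facts with §1 discharging that hypothesis,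
  `lem56AllN_sharpFlat_finite_selmer_of_finite_coinvariants_holds`,
  `lem56_sharpFlat_finite_selmer_of_finite_coinvariants_holds`.

HONEST FRAMING (cell `bsd-ssimc`, seat `bsd-ssimc-k3c5-kdot-split` g5, object «KDOT-CTRL-KERNEL»):
a discharge of two named facts inside the tree's transcription of Sprung's objects; nothing about
any curve is asserted; no census cell moves; BSD is not proved by any of this. The OTHER half of
Lemma 5.6 (`lem56[AllN]_sharpFlat_finite_coinvariants_of_finite_selmer`) remains reduced to the
`v = p` clause of Lemma 5.5 (`lem55[AllN]_…`, `ChromaticLocalInjectivity.lean`), not discharged.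

## References
* [Sprung2024] §5.2 p. 39 (the setting, `E⋆_{0,p} = E(ℚ_p) ⊗ ℚ_p/ℤ_p`), Lemma 5.6 and proof of
  Lemma 5.7 (p. 41); arXiv:1610.10017 §4 pp. 15–16.
* [Sprung2012] F. Sprung, J. Number Theory 132 (2012): Thm. 2.2 (p. 1487), Def. 3.1 (p. 1489),
  Def. 5.9, Prop. 5.7 (p. 1495), Def. 7.1–7.2 (p. 1500), Def. 7.9, 7.11 (p. 1503).
* [Kobayashi2003] S. Kobayashi, Invent. Math. 152 (2003), Thm. 9.3, Def. 1.1 and §2 p. 4.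
* [GreenbergLNM1716] R. Greenberg, LNM 1716 (1999), §3 Lemmas 3.1–3.2 (p. 86), §2 p. 72.

## Design
Theorems only; `noncomputable section`; `open scoped Classical`; one universe `u`; §1 in
`namespace Literature.NumberTheory.EllipticCurves.Sprung2012` (a statement about `colemanKer`), §2–§3
in `namespace Literature.NumberTheory.EllipticCurves.Sprung2024`.
-/

noncomputable section

open scoped Classical NumberField

open NumberField IsDedekindDomain Polynomial

universe u

/-! ## §1 `Ker Col⋆` kills `E(K_v)`: the bottom layer of the tower -/

namespace Literature.NumberTheory.EllipticCurves.Sprung2012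

open Literature.NumberTheory.EllipticCurves Literature.NumberTheory.GaloisRepresentations ZpExtension
  Literature.NumberTheory.EllipticCurves.Kobayashi2003 Literature.NumberTheory.EllipticCurves.Sprung2017

section Base

variable {K : Type u} [Field K] {p : ℕ} [Fact p.Prime] (κ : ZpExtension K p)
variable {E : Type u} [Field E] [Algebra K E] (ι : AlgebraicClosure K →ₐ[K] AlgebraicClosure E)
variable (W : WeierstrassCurve K)

/-- The constant coefficient of the image in `Λ` of an integral polynomial is its constant
coefficient. [folklore] -/
private theorem constantCoeff_toIwasawa (f : ℤ[X]) :
    PowerSeries.constantCoeff (toIwasawa p f) = ((f.coeff 0 : ℤ) : ℤ_[p]) := by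
  rw [show toIwasawa p f = ((f.map (Int.castRingHom ℤ_[p]) : ℤ_[p][X]) : PowerSeries ℤ_[p]) from rfl,
    Polynomial.constantCoeff_coe, Polynomial.coeff_map, eq_intCast]

/-- `ω_n(0) = (1 + 0)^{pⁿ} − 1 = 0`: the image of `ω_n` in `Λ` has vanishing constant coefficient.
[cite: Pollack2003, Thm. 6.17 (ω_n = (1+T)^{p^n} − 1)] -/
theorem constantCoeff_toIwasawa_cyclotomicOmega (n : ℕ) :
    PowerSeries.constantCoeff (toIwasawa p (cyclotomicOmega p n)) = 0 := by
  rw [constantCoeff_toIwasawa, cyclotomicOmega, Polynomial.coeff_zero_eq_eval_zero]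
  simp

/-- A multiple of `ω_n` in `Λ` has vanishing constant coefficient. [folklore] -/
private theorem constantCoeff_eq_zero_of_cyclotomicOmega_dvd {n : ℕ} {A : IwasawaAlgebra p}
    (h : toIwasawa p (cyclotomicOmega p n) ∣ A) : PowerSeries.constantCoeff A = 0 := by
  obtain ⟨q, rfl⟩ := h
  rw [map_mul, constantCoeff_toIwasawa_cyclotomicOmega, zero_mul]

/-- The constant coefficient of Sprung's pairing value `P_{n,x}(z) = ∑_{j<pⁿ} z(gʲx)(1+T)ʲ` is the
orbit sum `∑_{j<pⁿ} z(gʲx)` (evaluation at `T = 0`, i.e. at the trivial character of `Γ/Γ^{pⁿ}`).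
[cite: Sprung2012, Def. 3.1 (p. 1489)] -/
theorem constantCoeff_pairingSum (A : AddSubgroup (localPoints W E)) (g : Field.absoluteGaloisGroup E)
    (n : ℕ) (x : localPoints W E) (z : A →+ ℤ_[p]) :
    PowerSeries.constantCoeff (pairingSum W A g n x z) =
      ∑ j ∈ Finset.range (p ^ n), evalOn W A z (g ^ j • x) := by
  rw [pairingSum_def, map_sum]
  refine Finset.sum_congr rfl fun j _ => ?_
  rw [map_mul, map_pow, PowerSeries.constantCoeff_C, map_add, map_one, PowerSeries.constantCoeff_X,
    add_zero, one_pow, mul_one]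

/-- **`Ker Col⋆` kills the bottom layer `E(K_v) = E(K_0·K_v)`** — the inclusion
`E(ℚ_p) ⊗ ℚ_p/ℤ_p ⊆ E⋆_{0,p}` of Sprung 2024 p. 39 ("`E♯_{0,p} = E♭_{0,p} = E(ℚ_p) ⊗ ℚ_p/ℤ_p` …
[64, Proposition 5.7] and [64, Definition 7.2 and the preceding discussion] … [65, Proposition 4.7]"),
proved inside the tree's transcription: for `p ≠ 2`, `p ∣ a_p`, `g` a local lift of a topological
generator, `(cneg, c)` a Honda system (Thm. 2.2) and `z ∈ Ker Col⋆` (`colemanKer`), `z` vanishes on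
every point of `E(K_0·K_v)`. Proof (module docstring §1): the levels `n = 0, 1` of `IsColemanPair`
(Def. 7.2: `L♭ ≡ −z(c_0) (mod T)`, `L♯ ≡ −P_{1,c_1}(z) (mod ω_1)`), the Honda relations
`c_0 = (a_p − 2) c_{−1}`, `Tr_{1/0} c_1 = a_p c_0 − (p − 1) c_{−1}` with
`Tr_{1/0} = ∑_{k<p} g^k` (`localTraceOfEmb_succ_eq_sum_pow_smul`), the non-vanishing of the integers
`a_p − 2` and `a_p(a_p − 2) − (p − 1)` (`p ∣ a_p`, `p` odd), and the generation clause at level `0`.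
[cite: Sprung2024, §5.2 p. 39 (E⋆_{0,p} = E(ℚ_p) ⊗ ℚ_p/ℤ_p)]
[cite: Sprung2012, Def. 7.2 (p. 1500) and Thm. 2.2 (p. 1487)] -/
theorem colemanKer_apply_eq_zero_of_mem_localLayerPointsOfEmb_zero {ap : ℤ} (hp2 : p ≠ 2)
    (hap : (p : ℤ) ∣ ap) {g : Field.absoluteGaloisGroup E} (hg : κ.IsTopGenerator (resGalOfEmb ι g))
    {cneg : localPoints W E} {c : ℕ → localPoints W E} (hH : IsHondaSystem κ ι W ap g cneg c)
    (col : Chroma) {z : localTowerPointsOfEmb κ ι W →+ ℤ_[p]} (hz : z ∈ colemanKer κ ι W ap g c col)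
    {x : localPoints W E} (hx : x ∈ localLayerPointsOfEmb κ ι W 0) :
    z ⟨x, localLayerPointsOfEmb_le_localTowerPointsOfEmb κ ι W 0 hx⟩ = 0 := by
  obtain ⟨hcneg, hc, hc0, hTr1, -, hgen0, -, -, -⟩ := hH
  obtain ⟨Ls, Lf, hCP, hcol⟩ := hz
  have hle := fun n ↦ localLayerPointsOfEmb_le_localTowerPointsOfEmb κ ι W n
  have hprime : p.Prime := Fact.out
  -- the two integer coefficients are non-zero
  have hunit0 : (ap - 2 : ℤ) ≠ 0 := by
    intro h
    have h2 : ap = 2 := by linarith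
    rw [h2] at hap
    have hle2 := Int.le_of_dvd (by norm_num) hap
    have h2le := hprime.two_le
    omega
  have hunit1 : (ap * (ap - 2) - ((p : ℤ) - 1) : ℤ) ≠ 0 := by
    intro hN
    obtain ⟨m, rfl⟩ := hap
    have h1 : ((p : ℕ) : ℤ) ∣ 1 := ⟨1 - m * ((p : ℤ) * m - 2), by linear_combination hN⟩
    have hp1 : p = 1 := by exact_mod_cast Int.eq_one_of_dvd_one (by positivity) h1
    exact hprime.one_lt.ne' hp1
  -- notation: `t = z(c_{-1})`
  set t : ℤ_[p] := z ⟨cneg, hle 0 hcneg⟩ with ht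
  -- it suffices to show `t = 0` (generation clause at level `0`)
  suffices ht0 : t = 0 by
    let z₀ : localLayerPointsOfEmb κ ι W 0 →+ ℤ_[p] := z.comp (AddSubgroup.inclusion (hle 0))
    have hz₀ : z₀ = 0 := hgen0 z₀ (by
      rw [evalOn_of_mem W _ z₀ hcneg]
      exact ht0)
    have hzx := DFunLike.congr_fun hz₀ ⟨x, hx⟩
    rw [AddMonoidHom.zero_apply] at hzx
    exact hzx
  -- `z(c_0) = (a_p - 2) t`
  have hzc0 : z ⟨c 0, hle 0 (hc 0)⟩ = (ap - 2) • t := by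
    have h : (⟨c 0, hle 0 (hc 0)⟩ : localTowerPointsOfEmb κ ι W) = (ap - 2) • ⟨cneg, hle 0 hcneg⟩ :=
      Subtype.ext (by rw [AddSubgroupClass.coe_zsmul]; exact hc0)
    rw [h, map_zsmul]
  -- the trace `Tr_{1/0} c_1 = ∑_{k<p} g^k c_1` lies in the tower and `z` of it is `a_p z(c_0) - (p-1) t`
  have hTrmem : localTraceOfEmb κ ι W 0 1 (c 1) ∈ localTowerPointsOfEmb κ ι W := by
    rw [hTr1]
    exact sub_mem (AddSubgroup.zsmul_mem _ (hle 0 (hc 0)) _) (AddSubgroup.zsmul_mem _ (hle 0 hcneg) _)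
  have hzTr : z ⟨localTraceOfEmb κ ι W 0 1 (c 1), hTrmem⟩ = (ap * (ap - 2) - ((p : ℤ) - 1)) • t := by
    have h : (⟨localTraceOfEmb κ ι W 0 1 (c 1), hTrmem⟩ : localTowerPointsOfEmb κ ι W) =
        ap • ⟨c 0, hle 0 (hc 0)⟩ - ((p : ℤ) - 1) • ⟨cneg, hle 0 hcneg⟩ :=
      Subtype.ext (by
        rw [AddSubgroupClass.coe_sub, AddSubgroupClass.coe_zsmul, AddSubgroupClass.coe_zsmul]
        exact hTr1)
    rw [h, map_sub, map_zsmul, map_zsmul, hzc0, smul_smul, ← sub_smul]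
  have hsum : ∑ j ∈ Finset.range p, evalOn W (localTowerPointsOfEmb κ ι W) z (g ^ j • c 1) =
      z ⟨localTraceOfEmb κ ι W 0 1 (c 1), hTrmem⟩ := by
    have hmem : ∀ j : ℕ, g ^ j • c 1 ∈ localTowerPointsOfEmb κ ι W := fun j ↦
      smul_mem_localTowerPointsOfEmb κ ι W _ (hle 1 (hc 1))
    have h : (⟨localTraceOfEmb κ ι W 0 1 (c 1), hTrmem⟩ : localTowerPointsOfEmb κ ι W) =
        ∑ j ∈ Finset.range p, ⟨g ^ j • c 1, hmem j⟩ := by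
      apply Subtype.ext
      show localTraceOfEmb κ ι W 0 1 (c 1) =
        ((∑ j ∈ Finset.range p, (⟨g ^ j • c 1, hmem j⟩ : localTowerPointsOfEmb κ ι W) :
          localTowerPointsOfEmb κ ι W) : localPoints W E)
      rw [AddSubmonoidClass.coe_finsetSum, localTraceOfEmb_succ_eq_sum_pow_smul κ ι W hg 0 (hc 1)]
      refine Finset.sum_congr rfl fun j _ => ?_
      rw [pow_zero, one_mul]
    rw [h, map_sum]
    exact Finset.sum_congr rfl fun j _ => evalOn_of_mem W _ z (hmem j)
  -- level 0 of the Coleman characterisation: `z(c_0) + L♭(0) = 0`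
  have hlev0 : (ap - 2) • t + PowerSeries.constantCoeff Lf = 0 := by
    have h := hCP 0
    rw [sharpPoly_zero, flatPoly_zero, map_zero, map_one, zero_mul, one_mul, zero_add] at h
    have h' := constantCoeff_eq_zero_of_cyclotomicOmega_dvd h
    rw [map_add, constantCoeff_pairingSum] at h'
    simp only [pow_zero, Finset.sum_range_one, one_smul] at h'
    rwa [evalOn_of_mem W _ z (hle 0 (hc 0)), hzc0] at h'
  -- level 1: `z(Tr_{1/0} c_1) + L♯(0) = 0`
  have hlev1 : (ap * (ap - 2) - ((p : ℤ) - 1)) • t + PowerSeries.constantCoeff Ls = 0 := by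
    have h := hCP 1
    rw [sharpPoly_one, flatPoly_one, map_one, map_zero, one_mul, zero_mul, add_zero] at h
    have h' := constantCoeff_eq_zero_of_cyclotomicOmega_dvd h
    rw [map_add, constantCoeff_pairingSum, pow_one, hsum, hzTr] at h'
    exact h'
  -- colour by colour
  cases col with
  | sharp =>
    rw [chromaticL_sharp] at hcol
    rw [hcol, map_zero, add_zero, zsmul_eq_mul, mul_eq_zero] at hlev1
    exact hlev1.resolve_left (by exact_mod_cast hunit1)
  | flat =>
    rw [chromaticL_flat] at hcol
    rw [hcol, map_zero, add_zero, zsmul_eq_mul, mul_eq_zero] at hlev0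
    exact hlev0.resolve_left (by exact_mod_cast hunit0)

end Base

end Literature.NumberTheory.EllipticCurves.Sprung2012

/-! ## §2 The control map `s_0` lands in `Sel⋆(E/K_∞)` -/

namespace Literature.NumberTheory.EllipticCurves.Sprung2024

open Literature.NumberTheory.EllipticCurves Literature.NumberTheory.GaloisRepresentations
  Literature.NumberTheory.EllipticCurves.IwasawaAlgebra Literature.NumberTheory.EllipticCurves.IwasawaDual
  WeierstrassCurve ZpExtension Literature.NumberTheory.EllipticCurves.Kobayashi2003
  Literature.NumberTheory.EllipticCurves.Sprung2017 Literature.NumberTheory.EllipticCurves.Sprung2012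

variable {K : Type u} [Field K] [NumberField K] (W : WeierstrassCurve K) {p : ℕ} [Fact p.Prime]
  (κ : ZpExtension K p) (v : HeightOneSpectrum (𝓞 K))

/-- The layer subgroups `Gal(K̄/K_n)` are compact (open, hence closed, in the compact `Γ_K`).
[folklore] -/
private theorem compactSpace_layerSubgroup' (n : ℕ) : CompactSpace (κ.layerSubgroup n) := by
  haveI : CompactSpace (Field.absoluteGaloisGroup K) := compactSpace_absoluteGaloisGroup K
  exact isCompact_iff_compactSpace.mp
    (Subgroup.isClosed_of_isOpen _ (κ.isOpen_layerSubgroup n)).isCompact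

/-- **A class with the classical local condition at `v` satisfies Sprung's `⋆`-condition at `𝔭`
after restriction to `K_∞`, provided `Ker Col⋆` kills `E(K_v)`.** The classical condition at `v`
over `K_0 = K` is the Kummer condition cut out by `E(K_v) = E(K_0·K_v)` (tree
`Kobayashi2003.localKerOverOfEmb_le_localKummerOverOfEmb_fixedPoints`, the local Kummer sequence):
`y = [φ]`, `ι φ(τ) = τQ − Q` on `Γ_{K_v}`, `x = pᵏQ ∈ E(K_v)`; restricting `φ` to `Gal(K̄/K_∞)`
gives the same identity on `Gal(K̄_v/K_{∞,𝔭})`, `x ∈ E(K_{∞,𝔭})`, and the pairing clause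
`z(x) ∈ pᵏℤ_p` for `z ∈ Ker Col⋆` holds because `z(x) = 0` (hypothesis; §1 over `ℚ`).
[cite: Sprung2024, §5.2 p. 39 (E⋆_{0,p} = E(ℚ_p) ⊗ ℚ_p/ℤ_p)] [cite: Sprung2012, Def. 7.9 (p. 1503)]
[cite: Kobayashi2003, Def. 1.1 and §2 p. 4] -/
theorem layerToInfty_mem_sharpFlatLocalKummerOverOfEmb_of_mem_localKerOver {ap : ℤ}
    {g : Field.absoluteGaloisGroup (v.adicCompletion K)}
    {c : ℕ → localPoints W (v.adicCompletion K)} {col : Chroma}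
    (h𝒦 : ∀ z ∈ colemanKer κ (closureEmb (K := K) (v.adicCompletion K)) W ap g c col,
      ∀ (x : localPoints W (v.adicCompletion K))
        (hx : x ∈ localLayerPointsOfEmb κ (closureEmb (K := K) (v.adicCompletion K)) W 0),
        z ⟨x, localLayerPointsOfEmb_le_localTowerPointsOfEmb κ _ W 0 hx⟩ = 0)
    {y : W.subgroupH1 p (κ.layerSubgroup 0)}
    (hy : y ∈ W.localKerOver p (κ.layerSubgroup 0) (v.adicCompletion K)) :
    W.layerToInfty κ 0 y ∈ sharpFlatLocalKummerOverOfEmb W p κ.kerSubgroup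
        (closureEmb (K := K) (v.adicCompletion K))
        (localTowerPointsOfEmb κ (closureEmb (K := K) (v.adicCompletion K)) W)
        (colemanKer κ (closureEmb (K := K) (v.adicCompletion K)) W ap g c col) := by
  haveI : CompactSpace (κ.layerSubgroup 0) := compactSpace_layerSubgroup' κ 0
  change y ∈ W.localKerOverOfEmb p (κ.layerSubgroup 0) (closureEmb (K := K) (v.adicCompletion K))
    at hy
  obtain ⟨φ, Q, k, rfl, hA, hQ⟩ :=
    localKerOverOfEmb_le_localKummerOverOfEmb_fixedPoints W p (κ.layerSubgroup 0)
      (closureEmb (K := K) (v.adicCompletion K)) hy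
  -- `p^k Q ∈ E(K_0·K_v) ⊆ E(K_∞·K_v)`
  have hA' : (p ^ k) • Q ∈
      localTowerPointsOfEmb κ (closureEmb (K := K) (v.adicCompletion K)) W :=
    localLayerPointsOfEmb_le_localTowerPointsOfEmb κ _ W 0 hA
  -- restriction to `Gal(K̄/K_∞)` on cocycles
  have hres : Literature.NumberTheory.EllipticCurves.resOfLe (W.geomPrimaryTorsion p)
      (κ.kerSubgroup_le_layerSubgroup 0) (oneCocycleClass _ φ) =
      oneCocycleClass _ (contOneCocycles.pullback (subgroupInclusion (κ.kerSubgroup_le_layerSubgroup 0))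
        (resHomOfEquivariant (subgroupInclusion (κ.kerSubgroup_le_layerSubgroup 0))
          (AddMonoidHom.id (W.geomPrimaryTorsion p)) (fun _ _ ↦ rfl)) φ) :=
    map_oneCocycleClass _ _ _ φ
  change Literature.NumberTheory.EllipticCurves.resOfLe (W.geomPrimaryTorsion p)
    (κ.kerSubgroup_le_layerSubgroup 0) (oneCocycleClass _ φ) ∈ _
  rw [hres, mem_sharpFlatLocalKummerOverOfEmb_iff]
  refine ⟨_, Q, k, hA', rfl, fun z hz ↦ ?_, fun τ ↦ ?_⟩
  · rw [h𝒦 z hz _ hA]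
    exact dvd_zero _
  · have key := hQ ⟨(τ : Field.absoluteGaloisGroup (v.adicCompletion K)),
      _root_.WeierstrassCurve.localSubgroup_ker_le_layer κ (v.adicCompletion K) 0 τ.2⟩
    rw [contOneCocycles.pullback_apply]
    exact key

/-- **`h_0(Sel_{p^∞}(E/K_0)) ⊆ Sel⋆(E/K_∞)`** (the control map `s_0` exists), provided `Ker Col⋆`
kills `E(K_v)` at the chosen place `v`: the classical part is `map_layerToInfty_selmerLayer_le`; the
`⋆`-conditions at `𝔭` and its conjugates follow from the previous theorem applied to `conj_σ y`
(`h_0 ∘ conj_σ = conj_σ ∘ h_0`). [cite: Sprung2024, §5.2 Lemma 5.6 (p. 41) and p. 39]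
[cite: Sprung2012, Def. 7.11 (p. 1503)] [cite: GreenbergLNM1716, §2 p. 72] -/
theorem layerToInfty_mem_sharpFlatSelmerInfty_of_mem_selmerLayer_zero {ap : ℤ}
    {g : Field.absoluteGaloisGroup (v.adicCompletion K)}
    {c : ℕ → localPoints W (v.adicCompletion K)} {col : Chroma}
    (h𝒦 : ∀ z ∈ colemanKer κ (closureEmb (K := K) (v.adicCompletion K)) W ap g c col,
      ∀ (x : localPoints W (v.adicCompletion K))
        (hx : x ∈ localLayerPointsOfEmb κ (closureEmb (K := K) (v.adicCompletion K)) W 0),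
        z ⟨x, localLayerPointsOfEmb_le_localTowerPointsOfEmb κ _ W 0 hx⟩ = 0)
    {y : W.subgroupH1 p (κ.layerSubgroup 0)} (hy : y ∈ W.selmerLayer κ 0) :
    W.layerToInfty κ 0 y ∈
      sharpFlatSelmerInfty W κ (closureEmb (K := K) (v.adicCompletion K)) ap g c col := by
  rw [mem_sharpFlatSelmerInfty_iff]
  refine ⟨W.map_layerToInfty_selmerLayer_le_holds κ 0 (AddSubgroup.mem_map_of_mem _ hy), fun σ ↦ ?_⟩
  rw [← W.layerToInfty_conjH1 κ σ y]
  refine layerToInfty_mem_sharpFlatLocalKummerOverOfEmb_of_mem_localKerOver W κ v h𝒦 ?_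
  change y ∈ W.selmerGroupOver p (κ.layerSubgroup 0) at hy
  exact ((W.mem_selmerGroupOver_iff p (κ.layerSubgroup 0) y).mp hy).1 v σ

/-! ## §3 Finite kernel and assembly -/

/-- **`Sel_{p^∞}(E/K_0)` is finite when `Sel⋆(E/K_∞)^γ` and `ker h_0` are**, provided `Ker Col⋆`
kills `E(K_v)`: the control map `s_0 = h_0|_{Sel_0} : Sel_0 → Sel⋆(E/K_∞)` (§2) has kernel inside
`ker h_0` and image inside `Sel⋆(E/K_∞)^γ` (`range_layerToInfty_le_layerInvariants`, then
`conjH1_eq_of_mem_layerInvariants_zero`), and `#Sel_0 = #(Sel_0/ker s_0) · #ker s_0`.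
[cite: Sprung2024, §5.2 Lemma 5.6 (p. 41)] [cite: GreenbergLNM1716, §3 Lemmas 3.1–3.2 (p. 86)] -/
theorem finite_selmerLayer_zero_of_finite_endInvariants {ap : ℤ}
    {g : Field.absoluteGaloisGroup (v.adicCompletion K)}
    {c : ℕ → localPoints W (v.adicCompletion K)} {col : Chroma} {γ : Field.absoluteGaloisGroup K}
    (h𝒦 : ∀ z ∈ colemanKer κ (closureEmb (K := K) (v.adicCompletion K)) W ap g c col,
      ∀ (x : localPoints W (v.adicCompletion K))
        (hx : x ∈ localLayerPointsOfEmb κ (closureEmb (K := K) (v.adicCompletion K)) W 0),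
        z ⟨x, localLayerPointsOfEmb_le_localTowerPointsOfEmb κ _ W 0 hx⟩ = 0)
    (hker : Finite (W.layerToInfty κ 0).ker)
    (hT : Finite ↥(endInvariants
      (conjSharpFlatSelmerInfty W κ (closureEmb (K := K) (v.adicCompletion K)) ap g c col γ - 1))) :
    Finite ↥(W.selmerLayer κ 0) := by
  haveI := hker
  haveI := hT
  -- the control map `s_0` followed by the inclusion into `H¹(K_∞, E[p^∞])`
  let F : ↥(W.selmerLayer κ 0) →+ W.subgroupH1 p κ.kerSubgroup :=
    (W.layerToInfty κ 0).comp (W.selmerLayer κ 0).subtype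
  have hF : ∀ y : ↥(W.selmerLayer κ 0), F y = W.layerToInfty κ 0 (y : W.subgroupH1 p _) :=
    fun _ ↦ rfl
  -- `ker s_0 ↪ ker h_0`
  haveI : Finite F.ker := by
    let e : F.ker → (W.layerToInfty κ 0).ker := fun x ↦
      ⟨((x : ↥(W.selmerLayer κ 0)) : W.subgroupH1 p (κ.layerSubgroup 0)), by
        rw [AddMonoidHom.mem_ker, ← hF]; exact (AddMonoidHom.mem_ker).mp x.2⟩
    have he : ∀ x, ((e x : (W.layerToInfty κ 0).ker) : W.subgroupH1 p (κ.layerSubgroup 0)) =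
        ((x : ↥(W.selmerLayer κ 0)) : W.subgroupH1 p (κ.layerSubgroup 0)) := fun _ ↦ rfl
    refine Finite.of_injective e fun a b hab ↦ ?_
    have h := congrArg (fun z : (W.layerToInfty κ 0).ker ↦ (z : W.subgroupH1 p (κ.layerSubgroup 0))) hab
    simp only [he] at h
    exact Subtype.ext (Subtype.ext h)
  -- `im s_0 ↪ Sel⋆(E/K_∞)^γ`
  haveI : Finite F.range := by
    have hmem0 : ∀ y : ↥(W.selmerLayer κ 0), F y ∈
        sharpFlatSelmerInfty W κ (closureEmb (K := K) (v.adicCompletion K)) ap g c col := fun y ↦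
      layerToInfty_mem_sharpFlatSelmerInfty_of_mem_selmerLayer_zero W κ v h𝒦 y.2
    have hfix0 : ∀ y : ↥(W.selmerLayer κ 0), W.conjH1 p κ.kerSubgroup γ (F y) = F y := fun y ↦
      W.conjH1_eq_of_mem_layerInvariants_zero κ γ
        (W.range_layerToInfty_le_layerInvariants_holds κ 0 ⟨_, rfl⟩)
    have hmem : ∀ x : F.range, (x : W.subgroupH1 p κ.kerSubgroup) ∈
        sharpFlatSelmerInfty W κ (closureEmb (K := K) (v.adicCompletion K)) ap g c col := by
      intro x
      obtain ⟨y, hy⟩ := x.2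
      rw [← hy]
      exact hmem0 y
    have hfix : ∀ x : F.range,
        W.conjH1 p κ.kerSubgroup γ (x : W.subgroupH1 p κ.kerSubgroup) = x := by
      intro x
      obtain ⟨y, hy⟩ := x.2
      rw [← hy]
      exact hfix0 y
    let e : F.range → ↥(endInvariants
        (conjSharpFlatSelmerInfty W κ (closureEmb (K := K) (v.adicCompletion K)) ap g c col γ - 1)) :=
      fun x ↦ ⟨⟨(x : W.subgroupH1 p κ.kerSubgroup), hmem x⟩,
        (mem_endInvariants_conjSharpFlatSelmerInfty_iff γ _).mpr (hfix x)⟩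
    have he : ∀ x, (((e x : ↥(endInvariants _)) : sharpFlatSelmerInfty W κ
        (closureEmb (K := K) (v.adicCompletion K)) ap g c col) : W.subgroupH1 p κ.kerSubgroup) =
        (x : W.subgroupH1 p κ.kerSubgroup) := fun _ ↦ rfl
    refine Finite.of_injective e fun a b hab ↦ ?_
    have h := congrArg (fun z : ↥(endInvariants (conjSharpFlatSelmerInfty W κ
      (closureEmb (K := K) (v.adicCompletion K)) ap g c col γ - 1)) ↦
        ((z : sharpFlatSelmerInfty W κ (closureEmb (K := K) (v.adicCompletion K)) ap g c col) :
          W.subgroupH1 p κ.kerSubgroup)) hab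
    simp only [he] at h
    exact Subtype.ext h
  -- extension of finite by finite
  haveI hq : Finite (↥(W.selmerLayer κ 0) ⧸ F.ker) :=
    Finite.of_equiv _ (QuotientAddGroup.quotientKerEquivRange F).toEquiv.symm
  have hcard := AddSubgroup.card_eq_card_quotient_mul_card_addSubgroup F.ker
  have h1 : Nat.card (↥(W.selmerLayer κ 0) ⧸ F.ker) ≠ 0 :=
    (@Nat.card_pos _ ⟨0⟩ hq).ne'
  have h2 : Nat.card F.ker ≠ 0 := (@Nat.card_pos _ ⟨0⟩ inferInstance).ne'
  refine Nat.finite_of_card_ne_zero ?_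
  rw [hcard]
  exact mul_ne_zero h1 h2

/-- **Sprung 2024, Lemma 5.6, surjectivity half (corollary form), general form.** Let `K` be a number
field, `E/K` elliptic, `κ` any `ℤ_p`-extension with topological generator `γ`, `v` a finite place,
`Sel⋆(E/K_∞)` the chromatic Selmer group at the place of `K_∞` above `v` singled out by the chosen
embedding, for data `(ap, g, c, ⋆)` such that `Ker Col⋆` kills `E(K_v)` (§1: automatic for a Honda
system at a supersingular `p ≠ 2`), `D` any Pontryagin-dual datum, and assume `ker h_0` finite
(Greenberg's Lemma 3.1). THEN `X⋆/TX⋆` finite ⟹ `Sel_{p^∞}(E/K)` finite: `X⋆/TX⋆` finite ⟺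
`Sel⋆(E/K_∞)^γ` finite (`SharpFlatSelmerDualData.finite_coinvariants_iff`) ⟹ `Sel_0` finite
(`finite_selmerLayer_zero_of_finite_endInvariants`) and `Sel_0 ≃ Sel_{p^∞}(E/K)`
(`nonempty_selmerLayer_zero_addEquiv`). [cite: Sprung2024, §5.2 Lemma 5.6 and proof of Lemma 5.7 (p. 41)]
[cite: Kobayashi2003, Thm. 9.3] [cite: GreenbergLNM1716, §3 pp. 85–86] -/
theorem finite_selmer_of_finite_sharpFlat_coinvariants_of_colemanKer_apply_eq_zero {ap : ℤ}
    {g : Field.absoluteGaloisGroup (v.adicCompletion K)}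
    {c : ℕ → localPoints W (v.adicCompletion K)} {col : Chroma} {γ : Field.absoluteGaloisGroup K}
    (hγ : κ.IsTopGenerator γ)
    (h𝒦 : ∀ z ∈ colemanKer κ (closureEmb (K := K) (v.adicCompletion K)) W ap g c col,
      ∀ (x : localPoints W (v.adicCompletion K))
        (hx : x ∈ localLayerPointsOfEmb κ (closureEmb (K := K) (v.adicCompletion K)) W 0),
        z ⟨x, localLayerPointsOfEmb_le_localTowerPointsOfEmb κ _ W 0 hx⟩ = 0)
    (hker : Finite (W.layerToInfty κ 0).ker)
    (D : SharpFlatSelmerDualData W κ γ (closureEmb (K := K) (v.adicCompletion K)) ap g c col)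
    (hco : Finite (coinvariants p D.X)) : Finite (W.selmerGroupPInfty p) := by
  have hT := (D.finite_coinvariants_iff hγ).mp hco
  haveI := finite_selmerLayer_zero_of_finite_endInvariants W κ v h𝒦 hker hT
  obtain ⟨e⟩ := W.nonempty_selmerLayer_zero_addEquiv κ (p := p)
  exact Finite.of_equiv _ e.toEquiv

/-! ### The two named facts, DISCHARGED -/

/-- **DISCHARGE of `lem56AllN_sharpFlat_finite_selmer_of_finite_coinvariants`** (Sprung 2024,
Lemma 5.6, surjectivity half in corollary form, every conductor): for `W/ℚ`, `p ≠ 2` good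
supersingular (`p ∣ a_p`), the cyclotomic `(κ, γ)`, the place `v ∋ p`, a local lift `g`, a Honda
system `(cneg, c)`, either colour and every datum `D`: `X⋆/TX⋆` finite ⟹ `Sel_{p^∞}(E/ℚ)` finite.
From `finite_selmer_of_finite_sharpFlat_coinvariants_of_colemanKer_apply_eq_zero` with §1
(`colemanKer_apply_eq_zero_of_mem_localLayerPointsOfEmb_zero`, uses `p ≠ 2`, `p ∣ a_p`, `g`, the
Honda relations) and Greenberg's Lemma 3.1 (`Greenberg1999_ker_layerToInfty_bounded_holds`). The
binders good reduction and `IsCyclotomicVariable` are not used.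
[cite: Sprung2024, §5.2 Lemma 5.6 and proof of Lemma 5.7 (p. 41), p. 39]
[cite: Kobayashi2003, Thm. 9.3] [cite: GreenbergLNM1716, §3 Lemmas 3.1–3.2 (p. 86)] -/
theorem lem56AllN_sharpFlat_finite_selmer_of_finite_coinvariants_holds :
    lem56AllN_sharpFlat_finite_selmer_of_finite_coinvariants := by
  intro W _ _ p _ hp2 _hgood hap κ γ hκ hγ _hX v hv g hg cneg c hH col D hco
  obtain ⟨B, hB⟩ := W.Greenberg1999_ker_layerToInfty_bounded_holds κ hκ
  exact finite_selmer_of_finite_sharpFlat_coinvariants_of_colemanKer_apply_eq_zero W κ v hγ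
    (fun z hz x hx ↦ colemanKer_apply_eq_zero_of_mem_localLayerPointsOfEmb_zero κ _ W hp2 hap hg hH
      col hz hx) (hB 0).1 D hco

/-- **DISCHARGE of `lem56_sharpFlat_finite_selmer_of_finite_coinvariants`** (the printed §5.2 form,
square-free conductor; the binder `W.IsSemistable (𝓞 ℚ)` is not used).
[cite: Sprung2024, §5.2 Lemma 5.6 and proof of Lemma 5.7 (p. 41), p. 39]
[cite: Kobayashi2003, Thm. 9.3] [cite: GreenbergLNM1716, §3 Lemmas 3.1–3.2 (p. 86)] -/
theorem lem56_sharpFlat_finite_selmer_of_finite_coinvariants_holds :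
    lem56_sharpFlat_finite_selmer_of_finite_coinvariants := by
  intro W _ _ p _ hp2 _hss _hgood hap κ γ hκ hγ _hX v hv g hg cneg c hH col D hco
  obtain ⟨B, hB⟩ := W.Greenberg1999_ker_layerToInfty_bounded_holds κ hκ
  exact finite_selmer_of_finite_sharpFlat_coinvariants_of_colemanKer_apply_eq_zero W κ v hγ
    (fun z hz x hx ↦ colemanKer_apply_eq_zero_of_mem_localLayerPointsOfEmb_zero κ _ W hp2 hap hg hH
      col hz hx) (hB 0).1 D hco

end Literature.NumberTheory.EllipticCurves.Sprung2024

end
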